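import Mathlib.Algebra.Category.ModuleCat.Ext.Finite
import Mathlib.CategoryTheory.Abelian.Projective.Dimension
import Mathlib.RingTheory.Regular.ProjectiveDimension
import HarnessLib

/-!
# The cohomology annihilator of a commutative ring (Iyengar–Takahashi)

Topic: `Literature/RingTheory/CohomologyAnnihilator`.

For a commutative ring `R` and `n : ℕ`, Iyengar and Takahashi [IyengarTakahashi2014, Def. 2.1]
define the ideal
`caⁿ(R) := ann_R Ext^{≥ n}_R(mod R, mod R)`, i.e. the elements `a ∈ R` with `a · Extⁱ_R(M, N) = 0`
for all finitely generated `R`-modules `M`, `N` and all `i ≥ n`, and the **cohomology annihilator**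
`ca(R) := ⋃ₙ caⁿ(R)` (an increasing union, hence an ideal). (The paper works more generally with a
noether algebra `Λ` and its centre; we only vendor the commutative case `Λ = R = Z(Λ)`, which is
what the requesting route `ResolutionOfSingularities/HomologicalConductor` uses.)

We realise `Extⁱ_R(M, N)` as Mathlib's `CategoryTheory.Abelian.Ext M N i` for
`M N : ModuleCat.{u} R` (with `R : Type u`; the instance `HasExt.{u} (ModuleCat.{u} R)` comes from
`Mathlib.Algebra.Category.ModuleCat.Ext.HasExt`), with its `R`-module structure
`CategoryTheory.Abelian.Ext.instModule` coming from the `R`-linear structure of `ModuleCat R`.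

## Main definitions and results

* `cohomologyAnnihilatorOfDegree R n` — the ideal `caⁿ(R)` (Def. 2.1), as an infimum of
  annihilators; `mem_cohomologyAnnihilatorOfDegree_iff` unfolds it.
* `cohomologyAnnihilator R` — the ideal `ca(R) = ⨆ₙ caⁿ(R)`; `mem_cohomologyAnnihilator_iff'` and
  `coe_cohomologyAnnihilator` identify it with the set
  `{x | ∃ n, ∀ i ≥ n, ∀ M N f.g., ∀ e : Ext M N i, x • e = 0}` inlined (as a `let`) by the route
  file `Summits/ResolutionOfSingularities/ResolutionOfSingularities/Theses/HomologicalConductor`;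
  `Subalgebra.image_coe_cohomologyAnnihilator` is literally that `let` for a subalgebra `A ⊆ K`.
* `cohomologyAnnihilatorOfDegree_mono`, `exists_cohomologyAnnihilator_eq_of_isNoetherianRing` —
  the tower `caⁿ ⊆ caⁿ⁺¹` and its stabilisation `ca(R) = caˢ(R)` for noetherian `R` (Def. 2.1).
* `mem_cohomologyAnnihilatorOfDegree_iff_of_isNoetherianRing` — Remark 2.3: over a noetherian
  ring it suffices to annihilate `Extⁿ` (dimension shifting).
* `cohomologyAnnihilatorOfDegree_zero` — `ca⁰(R) = 0` for `R ≠ 0`.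
* `cohomologyAnnihilatorOfDegree_eq_top_iff_hasProjectiveDimensionLT` — Example 2.5:
  `caⁿ(R) = R` iff every finitely generated module has projective dimension `< n`
  (noetherian `R`); `cohomologyAnnihilator_eq_top_of_field` — `ca(k) = ca¹(k) = k` for a field.

The localisation inclusion `U⁻¹caⁿ(R) ⊆ caⁿ(U⁻¹R)` (Lemma 2.10(1)), the comparison with the
singular locus (Lemma 2.10(2), Theorems 5.3–5.4) and the curve case (Esentepe) are NOT in this
file; see the sibling files of this directory.
-/

noncomputable section

open CategoryTheory CategoryTheory.Abelian

universe u

namespace Literature.RingTheory.CohomologyAnnihilator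

variable (R : Type u) [CommRing R]

/-- The `n`-th **cohomology annihilator ideal** `caⁿ(R) := ann_R Ext^{≥ n}_R(mod R, mod R)` of a
commutative ring `R`: the elements `a ∈ R` such that `a · Extⁱ_R(M, N) = 0` for all finitely
generated `R`-modules `M`, `N` and all `i ≥ n`. Realised as the infimum, over `i ≥ n` and finitely
generated `M N : ModuleCat.{u} R`, of the annihilators of the `R`-modules `Ext M N i`.
[cite: IyengarTakahashi2014, Definition 2.1] -/
def cohomologyAnnihilatorOfDegree (n : ℕ) : Ideal R :=
  ⨅ (i : ℕ) (_ : n ≤ i) (M : ModuleCat.{u} R) (N : ModuleCat.{u} R) (_ : Module.Finite R M)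
    (_ : Module.Finite R N), Module.annihilator R (Ext.{u} M N i)

/-- The **cohomology annihilator** `ca(R) := ⋃ₙ caⁿ(R)` of a commutative ring `R` (the union of
the increasing tower `caⁿ(R) ⊆ caⁿ⁺¹(R)`, realised as the supremum of ideals; it is the set-theoretic
union by `mem_cohomologyAnnihilator_iff`). [cite: IyengarTakahashi2014, Definition 2.1] -/
def cohomologyAnnihilator : Ideal R :=
  ⨆ n : ℕ, cohomologyAnnihilatorOfDegree R n

variable {R}

/-- Unfolding of `caⁿ(R)`: `x ∈ caⁿ(R)` iff `x • e = 0` for every `e : Extⁱ(M, N)`, `i ≥ n`,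
`M`, `N` finitely generated. [cite: IyengarTakahashi2014, Definition 2.1] -/
theorem mem_cohomologyAnnihilatorOfDegree_iff {n : ℕ} {x : R} :
    x ∈ cohomologyAnnihilatorOfDegree R n ↔
      ∀ i : ℕ, n ≤ i → ∀ (M N : ModuleCat.{u} R), Module.Finite R M → Module.Finite R N →
        ∀ e : Ext.{u} M N i, x • e = 0 := by
  simp [cohomologyAnnihilatorOfDegree, Module.mem_annihilator]

/-- An element of `caⁿ(R)` kills `Extⁱ(M, N)` for `i ≥ n` and `M`, `N` finitely generated.
[cite: IyengarTakahashi2014, Definition 2.1] -/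
theorem smul_eq_zero_of_mem_cohomologyAnnihilatorOfDegree {n : ℕ} {x : R}
    (hx : x ∈ cohomologyAnnihilatorOfDegree R n) {i : ℕ} (hi : n ≤ i) {M N : ModuleCat.{u} R}
    [Module.Finite R M] [Module.Finite R N] (e : Ext.{u} M N i) : x • e = 0 :=
  mem_cohomologyAnnihilatorOfDegree_iff.mp hx i hi M N ‹_› ‹_› e

/-- The tower `⋯ ⊆ caⁿ(R) ⊆ caⁿ⁺¹(R) ⊆ ⋯`. [cite: IyengarTakahashi2014, Definition 2.1] -/
theorem cohomologyAnnihilatorOfDegree_mono : Monotone (cohomologyAnnihilatorOfDegree R) := by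
  intro m n hmn x hx
  rw [mem_cohomologyAnnihilatorOfDegree_iff] at hx ⊢
  exact fun i hi => hx i (hmn.trans hi)

/-- `ca(R)` is the union of the `caⁿ(R)`. [cite: IyengarTakahashi2014, Definition 2.1] -/
theorem mem_cohomologyAnnihilator_iff {x : R} :
    x ∈ cohomologyAnnihilator R ↔ ∃ n, x ∈ cohomologyAnnihilatorOfDegree R n :=
  Submodule.mem_iSup_of_directed _ cohomologyAnnihilatorOfDegree_mono.directed_le

/-- `caⁿ(R) ⊆ ca(R)`. [cite: IyengarTakahashi2014, Definition 2.1] -/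
theorem cohomologyAnnihilatorOfDegree_le (n : ℕ) :
    cohomologyAnnihilatorOfDegree R n ≤ cohomologyAnnihilator R :=
  le_iSup (cohomologyAnnihilatorOfDegree R) n

/-- Unfolding of `ca(R)`: `x ∈ ca(R)` iff for some `n`, `x • e = 0` for every `e : Extⁱ(M, N)`,
`i ≥ n`, `M`, `N` finitely generated. [cite: IyengarTakahashi2014, Definition 2.1] -/
theorem mem_cohomologyAnnihilator_iff' {x : R} :
    x ∈ cohomologyAnnihilator R ↔ ∃ n : ℕ, ∀ i : ℕ, n ≤ i → ∀ (M N : ModuleCat.{u} R),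
      Module.Finite R M → Module.Finite R N → ∀ e : Ext.{u} M N i, x • e = 0 := by
  simp only [mem_cohomologyAnnihilator_iff, mem_cohomologyAnnihilatorOfDegree_iff]

/-- `ca(R)` as a set is `{x | ∃ n, ∀ i ≥ n, ∀ M N f.g., ∀ e : Ext M N i, x • e = 0}` — the set the
route file `…/Theses/HomologicalConductor.lean` inlines as `let ca`.
[cite: IyengarTakahashi2014, Definition 2.1] -/
theorem coe_cohomologyAnnihilator :
    (cohomologyAnnihilator R : Set R) = {x | ∃ n : ℕ, ∀ i : ℕ, n ≤ i → ∀ (M N : ModuleCat.{u} R),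
      Module.Finite R M → Module.Finite R N → ∀ e : Ext.{u} M N i, x • e = 0} :=
  Set.ext fun _ => mem_cohomologyAnnihilator_iff'

/-- For a subalgebra `A` of `K`, the image of `ca(A)` in `K` is literally the set
`{x : K | ∃ hx : x ∈ A, ∃ n, ∀ i ≥ n, ∀ M N f.g., ∀ e : Ext M N i, ⟨x, hx⟩ • e = 0}` bound as
`let ca` in every item of the route `ResolutionOfSingularities/HomologicalConductor` (take
`u = 0`). [cite: IyengarTakahashi2014, Definition 2.1] -/
theorem _root_.Subalgebra.image_coe_cohomologyAnnihilator {k K : Type u} [CommRing k] [CommRing K]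
    [Algebra k K] (A : Subalgebra k K) :
    ((↑) : A → K) '' (cohomologyAnnihilator A : Set A) =
      {x : K | ∃ hx : x ∈ A, ∃ n : ℕ, ∀ i : ℕ, n ≤ i → ∀ (M N : ModuleCat.{u} A),
        Module.Finite A M → Module.Finite A N →
          ∀ e : CategoryTheory.Abelian.Ext.{u} M N i, (⟨x, hx⟩ : A) • e = 0} := by
  ext x
  simp only [Set.mem_image, SetLike.mem_coe, mem_cohomologyAnnihilator_iff', Set.mem_setOf_eq]
  constructor
  · rintro ⟨⟨y, hy⟩, h, rfl⟩
    exact ⟨hy, h⟩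
  · rintro ⟨hx, h⟩
    exact ⟨⟨x, hx⟩, h, rfl⟩

/-- As `R` is noetherian, the tower `caⁿ(R)` stabilises: `ca(R) = caˢ(R)` for some `s`.
[cite: IyengarTakahashi2014, Definition 2.1] -/
theorem exists_cohomologyAnnihilator_eq_of_isNoetherianRing [IsNoetherianRing R] :
    ∃ s : ℕ, cohomologyAnnihilator R = cohomologyAnnihilatorOfDegree R s := by
  obtain ⟨s, hs⟩ := monotone_stabilizes_iff_noetherian.mpr (inferInstance : IsNoetherian R R)
    ⟨cohomologyAnnihilatorOfDegree R, cohomologyAnnihilatorOfDegree_mono⟩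
  refine ⟨s, le_antisymm (iSup_le fun n => ?_) (cohomologyAnnihilatorOfDegree_le s)⟩
  calc cohomologyAnnihilatorOfDegree R n ≤ cohomologyAnnihilatorOfDegree R (max n s) :=
        cohomologyAnnihilatorOfDegree_mono (le_max_left n s)
    _ = cohomologyAnnihilatorOfDegree R s := (hs (max n s) (le_max_right n s)).symm

/-- Dimension shifting (Remark 2.3): if `x` kills `Extⁿ(M, N)` for all finitely generated `M`, `N`
over a noetherian ring, then it kills `Extⁿ⁺¹(M, N)` for all such `M`, `N` — using the
`R`-linear surjection `Extⁿ(ΩM, N) ↠ Extⁿ⁺¹(M, N)` attached to a presentation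
`0 → ΩM → P → M → 0` with `P` finite free. [cite: IyengarTakahashi2014, Remark 2.3] -/
theorem forall_smul_ext_succ_eq_zero [IsNoetherianRing R] {n : ℕ} {x : R}
    (h : ∀ (M N : ModuleCat.{u} R), Module.Finite R M → Module.Finite R N →
      ∀ e : Ext.{u} M N n, x • e = 0)
    (M N : ModuleCat.{u} R) [Module.Finite R M] [Module.Finite R N] (e : Ext.{u} M N (n + 1)) :
    x • e = 0 := by
  obtain ⟨P, _, _, _, _, f, surjf⟩ := Module.exists_finite_presentation R M
  have hS := LinearMap.shortExact_shortComplexKer surjf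
  obtain ⟨e', rfl⟩ := precomp_extClass_surjective_of_projective_X₂ N hS n e
  have : Module.Finite R (LinearMap.ker f) := Module.IsNoetherian.finite R _
  have h' := h (ModuleCat.of R (LinearMap.ker f)) N inferInstance ‹_› e'
  change x • (hS.extClass.precompOfLinear R N (add_comm 1 n)) e' = 0
  rw [← LinearMap.map_smul, h', LinearMap.map_zero]

/-- **Remark 2.3**: over a noetherian ring, `caⁿ(R) = ann_R Extⁿ_R(mod R, mod R)` — it suffices to
annihilate `Ext` in the single degree `n`. [cite: IyengarTakahashi2014, Remark 2.3] -/
theorem mem_cohomologyAnnihilatorOfDegree_iff_of_isNoetherianRing [IsNoetherianRing R] {n : ℕ}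
    {x : R} :
    x ∈ cohomologyAnnihilatorOfDegree R n ↔
      ∀ (M N : ModuleCat.{u} R), Module.Finite R M → Module.Finite R N →
        ∀ e : Ext.{u} M N n, x • e = 0 := by
  rw [mem_cohomologyAnnihilatorOfDegree_iff]
  refine ⟨fun h => h n le_rfl, fun h i hi => ?_⟩
  obtain ⟨k, rfl⟩ := Nat.exists_eq_add_of_le hi
  clear hi
  induction k with
  | zero => simpa using h
  | succ k ih =>
    intro M N hM hN e
    exact forall_smul_ext_succ_eq_zero (n := n + k) ih M N e

/-- `ca⁰(R) = 0` for a non-zero ring: an element of `ca⁰(R)` kills `𝟙_R ∈ Hom_R(R, R) = Ext⁰(R, R)`.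
[cite: IyengarTakahashi2014, Definition 2.1] -/
theorem cohomologyAnnihilatorOfDegree_zero [Nontrivial R] :
    cohomologyAnnihilatorOfDegree R 0 = ⊥ := by
  rw [eq_bot_iff]
  intro x hx
  have h := smul_eq_zero_of_mem_cohomologyAnnihilatorOfDegree hx le_rfl
    (M := ModuleCat.of R R) (N := ModuleCat.of R R) (Ext.mk₀ (𝟙 _))
  rw [← Ext.mk₀_smul, ← Ext.mk₀_zero] at h
  have h' : (x • 𝟙 (ModuleCat.of R R) : ModuleCat.of R R ⟶ ModuleCat.of R R) = 0 :=
    (Ext.mk₀_bijective _ _).1 h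
  have := congrArg (fun φ : ModuleCat.of R R ⟶ ModuleCat.of R R => φ.hom (1 : R)) h'
  simpa using this

/-- `caⁿ(R) = R` iff `Extⁱ(M, N) = 0` for all `i ≥ n` and all finitely generated `M`, `N`.
[cite: IyengarTakahashi2014, Example 2.5] -/
theorem cohomologyAnnihilatorOfDegree_eq_top_iff {n : ℕ} :
    cohomologyAnnihilatorOfDegree R n = ⊤ ↔
      ∀ i : ℕ, n ≤ i → ∀ (M N : ModuleCat.{u} R), Module.Finite R M → Module.Finite R N →
        ∀ e : Ext.{u} M N i, e = 0 := by
  simp only [Ideal.eq_top_iff_one, mem_cohomologyAnnihilatorOfDegree_iff, one_smul]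

/-- **Example 2.5** (one direction, any commutative ring): if every finitely generated `R`-module
has projective dimension `< n` then `caⁿ(R) = R`. [cite: IyengarTakahashi2014, Example 2.5] -/
theorem cohomologyAnnihilatorOfDegree_eq_top_of_hasProjectiveDimensionLT {n : ℕ}
    (h : ∀ M : ModuleCat.{u} R, Module.Finite R M → HasProjectiveDimensionLT M n) :
    cohomologyAnnihilatorOfDegree R n = ⊤ := by
  rw [cohomologyAnnihilatorOfDegree_eq_top_iff]
  intro i hi M N hM _ e
  haveI := h M hM
  exact e.eq_zero_of_hasProjectiveDimensionLT n hi

/-- **Example 2.5** (converse, noetherian ring): if `caⁿ(R) = R` then every finitely generated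
`R`-module has projective dimension `< n` (for a finitely generated module over a noetherian ring
the vanishing of `Extⁿ(M, L)` may be tested on finitely generated `L`).
[cite: IyengarTakahashi2014, Example 2.5] -/
theorem hasProjectiveDimensionLT_of_cohomologyAnnihilatorOfDegree_eq_top [IsNoetherianRing R]
    {n : ℕ} (h : cohomologyAnnihilatorOfDegree R n = ⊤) (M : ModuleCat.{u} R) [Module.Finite R M] :
    HasProjectiveDimensionLT M n :=
  ModuleCat.hasProjectiveDimensionLT_of_forall_finite M n fun L hL =>
    ⟨fun a b => by
      rw [cohomologyAnnihilatorOfDegree_eq_top_iff] at h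
      rw [h n le_rfl M L ‹_› hL a, h n le_rfl M L ‹_› hL b]⟩

/-- **Example 2.5**: over a noetherian ring, `caⁿ(R) = R` iff every finitely generated module has
projective dimension `< n` ("`gldim R ≤ d` iff `caᵈ⁺¹(R) = R`").
[cite: IyengarTakahashi2014, Example 2.5] -/
theorem cohomologyAnnihilatorOfDegree_eq_top_iff_hasProjectiveDimensionLT [IsNoetherianRing R]
    {n : ℕ} :
    cohomologyAnnihilatorOfDegree R n = ⊤ ↔
      ∀ M : ModuleCat.{u} R, Module.Finite R M → HasProjectiveDimensionLT M n :=
  ⟨fun h M _ => hasProjectiveDimensionLT_of_cohomologyAnnihilatorOfDegree_eq_top h M,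
    cohomologyAnnihilatorOfDegree_eq_top_of_hasProjectiveDimensionLT⟩

/-- `ca(R) = R` iff `caⁿ(R) = R` for some `n`. [cite: IyengarTakahashi2014, Definition 2.1] -/
theorem cohomologyAnnihilator_eq_top_iff :
    cohomologyAnnihilator R = ⊤ ↔ ∃ n, cohomologyAnnihilatorOfDegree R n = ⊤ := by
  simp only [Ideal.eq_top_iff_one, mem_cohomologyAnnihilator_iff]

/-- Over a field every module is projective, so `Ext^{≥ 1} = 0` and `ca¹(k) = k`.
[cite: IyengarTakahashi2014, Example 2.5] -/
theorem cohomologyAnnihilatorOfDegree_one_eq_top_of_field (k : Type u) [Field k] :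
    cohomologyAnnihilatorOfDegree k 1 = ⊤ :=
  cohomologyAnnihilatorOfDegree_eq_top_of_hasProjectiveDimensionLT fun M _ =>
    haveI : Module.Free k M := Module.Free.of_divisionRing k M
    haveI : Module.Projective k M := Module.Projective.of_free
    projective_iff_hasProjectiveDimensionLT_one.mp M.projective_of_categoryTheory_projective

/-- The cohomology annihilator of a field is the unit ideal. [cite: IyengarTakahashi2014, Example 2.5] -/
theorem cohomologyAnnihilator_eq_top_of_field (k : Type u) [Field k] :
    cohomologyAnnihilator k = ⊤ :=
  cohomologyAnnihilator_eq_top_iff.mpr ⟨1, cohomologyAnnihilatorOfDegree_one_eq_top_of_field k⟩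

end Literature.RingTheory.CohomologyAnnihilator
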